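import Literature.Analysis.FluidPDE.PeriodicCylinderHelmholtz
import Literature.Analysis.FluidPDE.PeriodicCylinderCellTranslates
import HarnessLib

/-!
# Symmetries of the period cell: the periodic axial shift, the rotations about the axis, their
unitary actions on `L²(cell)`, and the periodisation of test functions

Topic `Literature/Analysis/FluidPDE`. Second foundational file (definitions with their API;
everything proved, no named facts) of the regularity theory for the periodic Neumann problem on
the cylinder `{r ≤ 1} × ℝ/Lℤ` (`PeriodicCylinderHelmholtz.lean`), the analytic input of the local
existence theorem for the Euler equations in the periodic cylinder (T. Kato, C. Y. Lai, J. Funct.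
Anal. **56** (1984), Thm I/II; the tree's named fact
`Literature.Analysis.FluidPDE.KatoLai1984_periodicCylinderUniformExistence`). Tangential regularity of
weak solutions up to the curved wall is obtained by Nirenberg's method of **difference quotients
along the symmetries of the domain** (L. Nirenberg, *Remarks on strongly elliptic partial differential
equations*, CPAM 8 (1955) — the reference `[11]` of Kato–Lai for their (5.5)): here the wall
`{r = 1}` is invariant under the rotations `R_θ` about the axis and the axial translations, and no
flattening of the boundary is needed. This file constructs these symmetries **at the level of the
Hilbert space `L²(cell)`** of `PeriodicCylinderHelmholtz.lean`, where the period cell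
`cell = {r < 1} × (0, L)` is a fundamental domain and the axial translations act through
`z ↦ (z + a) mod L`:

* `PeriodicCylinder.axialRed L x = x − ⌊z/L⌋ L e_z` (reduction into the slab `0 ≤ z < L`, the identity
  on the cell, `L`-periodic, invisible to periodic functions: `IsAxiallyPeriodic.comp_axialRed`) and
  `PeriodicCylinder.cellShift L a = axialRed ∘ (· + a e_z)`, the action of `ℝ/Lℤ` on the cell;
* **shift invariance of cell integrals of periodic functions**, `∫⁻_cell G(· + c e_z) = ∫⁻_cell G` for
  every real `c` (`setLIntegral_comp_add_smul_eZ`: the translate `{r<1} × (c, c+L)` of the cell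
  splits at `z = L` into a part of the cell and the `L`-translate of the rest, up to null faces;
  the tree had the integer case `lintegral_intTranslate_cylinderCell_eq`), whence
  **`cellShift L a` preserves the cell measure** (`map_cellShift_eq`, `measurePreserving_cellShift`:
  test against `g ∘ axialRed`, which is periodic); and `measurePreserving_rotZ_cell` (the rotations,
  linear isometries preserving the cell);
* the induced **linear isometries of `L²(cell; E)`**: `axialShiftLp L a` (`f ↦ f ∘ τ_a`), `rotLp L θ`
  (`f ↦ f ∘ R_θ`) — Mathlib's `Lp.compMeasurePreservingₗᵢ` — and on vector fields
  `rotFieldLp L θ : v ↦ R_{−θ} ∘ v ∘ R_θ` (the pull-back under which `∇(q ∘ R_θ) = R_θ⁻¹(∇q) ∘ R_θ`),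
  with their a.e. formulas and their values on cell classes of (periodic) functions
  (`axialShiftLp_toCell`, `rotLp_toCell`, `rotFieldLp_toCell`), and the invariance of the smooth
  periodic class (`IsSmoothPeriodic.comp_add_smul_eZ`, `.comp_rotZ`, `.rotZ_comp_rotZ`);
* `PeriodicCylinder.periodize L φ = φ ∘ axialRed` — **the periodisation of a test function on the
  cell is smooth** (`contDiff_periodize`: off the faces `z ∈ Lℤ` the reduction is locally a
  translation; near a face the periodisation vanishes identically, a compact subset of the cell
  keeping a positive axial distance from the faces, `exists_axial_margin`), periodic, equal to `φ`
  on the cell with the same derivatives there (`periodize_eq_self`, `fderiv_periodize_eq`) — so that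
  interior test functions on the cell are admissible in the periodic weak formulations.

## Design

All objects are concrete maps of `ℝ³` (no quotient types); the `L²` actions are total in `L`
(`axialShiftLp` is the identity for `L ≤ 0`, junk; every use is guarded by `0 < L`).

## What is NOT here

The invariance of the gradient space `𝓖`, of the potential graph and of the weak Neumann problem
under these actions, the difference quotients and their limits (sequel files).

Mathlib/tree search: tree — `rotZ`, `rotZL`, `rotZLIE`, `norm_rotZ`, `cylRadius_rotZ`, `rotZ_apply_two`
(`AxisymmetricEuler`, `AxisymmetricVorticityTransport`), `closure_unitCylinder`,
`rotZ_mem_closure_unitCylinder_iff`, `add_axialShift_mem_closure_unitCylinder_iff`,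
`IsAxiallyPeriodic.comp_rotZ`, `IsAxiallyPeriodic.add_int_mul` (`KatoLaiPeriodicCylinder(Proofs)`),
`lintegral_axialTranslate_cylinderCell_eq` (`PeriodicCylinderCellTranslates`), `volume_setOf_apply_two_eq`,
`eZ`, `toCell`, `cellMeasure`, `IsSmoothPeriodic` (`PeriodicCylinderHelmholtz`); a measure-preserving
`rotZ` on the whole space exists in `KNSSAxisymmetricNoSwirl` (`measurePreserving_rotZ`, heavy import —
rederived here in one line from `rotZLIE`). Mathlib — `Lp.compMeasurePreservingₗᵢ`,
`Lp.coeFn_compMeasurePreserving`, `MemLp.comp_measurePreserving`, `ContinuousLinearMap.compLp(ₗ)`,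
`Measure.ext_of_lintegral`, `lintegral_map`, `lintegral_add_right_eq_self`, `lintegral_union`,
`ae_eq_set`, `Int.sub_floor_div_mul_nonneg/lt`, `Int.measurable_floor`, `Int.floor_eq_iff`,
`MeasurePreserving.restrict_preimage`, `LinearIsometryEquiv.measurePreserving`.

## References

* L. Nirenberg, *Remarks on strongly elliptic partial differential equations*, Comm. Pure Appl. Math.
  8 (1955) 649–675 (difference quotients; Kato–Lai's reference [11]). [folklore]
* T. Kato, C. Y. Lai, *Nonlinear evolution equations and the Euler flow*, J. Funct. Anal. 56 (1984)
  15–28, §5. [KatoLai1984]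
-/

noncomputable section

open MeasureTheory Set Function Filter Topology TopologicalSpace WithLp Metric
open scoped ContDiff NNReal ENNReal InnerProductSpace RealInnerProductSpace

namespace Literature.Analysis.FluidPDE

open Literature.Analysis.FunctionSpaces

/-- Local notation for physical space `ℝ³ = EuclideanSpace ℝ (Fin 3)`. -/
local notation "ℝ³" => EuclideanSpace ℝ (Fin 3)

/-- Local notation for the closed unit cylinder `{r ≤ 1}`. -/
local notation "𝕂" => closure (SetLike.coe unitCylinder : Set (EuclideanSpace ℝ (Fin 3)))

namespace PeriodicCylinder

/-! ### The axial unit vector and axial translations -/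

/-- `e_z = EuclideanSpace.single 2 1` (the tree's `eZ`), the form in which `IsAxiallyPeriodic` is
stated. [folklore] -/
theorem eZ_eq_single : (eZ : ℝ³) = EuclideanSpace.single (2 : Fin 3) (1 : ℝ) := rfl

/-- Components of `e_z`. [folklore] -/
@[simp] theorem eZ_apply_two : (eZ : ℝ³) 2 = 1 := by simp [eZ_eq_single]

/-- `(e_z)₀ = 0`. [folklore] -/
@[simp] theorem eZ_apply_zero : (eZ : ℝ³) 0 = 0 := by simp [eZ_eq_single]

/-- `(e_z)₁ = 0`. [folklore] -/
@[simp] theorem eZ_apply_one : (eZ : ℝ³) 1 = 0 := by simp [eZ_eq_single]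

/-- Components of `t • e_z`. [folklore] -/
@[simp] theorem smul_eZ_apply_two (t : ℝ) : (t • (eZ : ℝ³)) 2 = t := by
  simp [eZ_eq_single]

/-- `(t e_z)₀ = 0`. [folklore] -/
@[simp] theorem smul_eZ_apply_zero (t : ℝ) : (t • (eZ : ℝ³)) 0 = 0 := by
  simp [eZ_eq_single]

/-- `(t e_z)₁ = 0`. [folklore] -/
@[simp] theorem smul_eZ_apply_one (t : ℝ) : (t • (eZ : ℝ³)) 1 = 0 := by
  simp [eZ_eq_single]

/-- The radius is invariant under axial translations. [folklore] -/
theorem cylRadius_add_smul_eZ (x : ℝ³) (t : ℝ) : cylRadius (x + t • eZ) = cylRadius x := by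
  simp [cylRadius]

/-- An `L`-periodic function is invariant under translation by `kL e_z`, `k : ℤ`. [folklore] -/
theorem _root_.Literature.Analysis.FluidPDE.IsAxiallyPeriodic.add_int_mul_smul_eZ {F : Sort*} {L : ℝ}
    {v : ℝ³ → F} (hv : IsAxiallyPeriodic L v) (k : ℤ) (x : ℝ³) :
    v (x + ((k : ℝ) * L) • eZ) = v x :=
  hv.add_int_mul k x

variable {L : ℝ}

/-! ### The axial reduction into the fundamental slab `0 ≤ z < L` -/

variable (L) in
/-- **Axial reduction** `x ↦ x − ⌊z/L⌋ L e_z`: subtracts the integer multiple of the period that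
brings the axial coordinate into `[0, L)`; the identity on the cell. [folklore] -/
def axialRed (x : ℝ³) : ℝ³ := x - ((⌊x 2 / L⌋ : ℝ) * L) • eZ

/-- The axial coordinate of the reduction. [folklore] -/
theorem axialRed_apply_two (x : ℝ³) : axialRed L x 2 = x 2 - (⌊x 2 / L⌋ : ℝ) * L := by
  simp [axialRed]

/-- The reduction does not change the radius. [folklore] -/
theorem cylRadius_axialRed (x : ℝ³) : cylRadius (axialRed L x) = cylRadius x := by
  rw [axialRed, sub_eq_add_neg, ← neg_smul, cylRadius_add_smul_eZ]

/-- The reduced axial coordinate is `≥ 0`. [folklore] -/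
theorem axialRed_apply_two_nonneg (hL : 0 < L) (x : ℝ³) : 0 ≤ axialRed L x 2 := by
  rw [axialRed_apply_two]
  exact Int.sub_floor_div_mul_nonneg (x 2) hL

/-- The reduced axial coordinate is `< L`. [folklore] -/
theorem axialRed_apply_two_lt (hL : 0 < L) (x : ℝ³) : axialRed L x 2 < L := by
  rw [axialRed_apply_two]
  exact Int.sub_floor_div_mul_lt (x 2) hL

/-- The axial reduction is the identity on the slab `0 ≤ z < L`, in particular on the cell. [folklore] -/
theorem axialRed_eq_self (hL : 0 < L) {x : ℝ³} (h0 : 0 ≤ x 2) (h1 : x 2 < L) : axialRed L x = x := by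
  have hfloor : ⌊x 2 / L⌋ = 0 := by
    rw [Int.floor_eq_zero_iff]
    exact ⟨div_nonneg h0 hL.le, (div_lt_one hL).2 h1⟩
  simp [axialRed, hfloor]

/-- The reduction is the identity on the cell. [folklore] -/
theorem axialRed_eq_self_of_mem_cell (hL : 0 < L) {x : ℝ³} (hx : x ∈ (cylinderCell L : Set ℝ³)) :
    axialRed L x = x :=
  axialRed_eq_self hL hx.2.1.le hx.2.2

/-- The axial reduction is `L`-periodic. [folklore] -/
theorem axialRed_add_period (hL : 0 < L) (x : ℝ³) : axialRed L (x + L • eZ) = axialRed L x := by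
  have h2 : (x + L • eZ) 2 = x 2 + L := by simp
  have hfloor : ⌊(x 2 + L) / L⌋ = ⌊x 2 / L⌋ + 1 := by
    rw [add_div, div_self hL.ne', Int.floor_add_one]
  simp only [axialRed, h2, hfloor, Int.cast_add, Int.cast_one]
  rw [add_mul, one_mul, add_smul]
  abel

/-- The reduction is `L`-periodic (as a function). [folklore] -/
theorem isAxiallyPeriodic_axialRed (hL : 0 < L) : IsAxiallyPeriodic L (axialRed L) :=
  fun x => axialRed_add_period hL x

/-- A periodic function does not see the axial reduction. [folklore] -/
theorem _root_.Literature.Analysis.FluidPDE.IsAxiallyPeriodic.comp_axialRed {F : Sort*} {v : ℝ³ → F}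
    (hv : IsAxiallyPeriodic L v) (x : ℝ³) : v (axialRed L x) = v x := by
  have h := hv.add_int_mul_smul_eZ (-⌊x 2 / L⌋) (x)
  rw [axialRed, sub_eq_add_neg, ← neg_smul, ← neg_mul, ← Int.cast_neg]
  exact h

/-- Measurability of the axial reduction. [folklore] -/
theorem measurable_axialRed : Measurable (axialRed L) := by
  have h2 : Measurable fun x : ℝ³ => x 2 := (EuclideanSpace.proj (2 : Fin 3)).continuous.measurable
  have hfl : Measurable fun x : ℝ³ => ((⌊x 2 / L⌋ : ℤ) : ℝ) :=
    (measurable_from_top (f := fun k : ℤ => (k : ℝ))).comp (Int.measurable_floor.comp (h2.div_const L))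
  exact measurable_id.sub (hfl.mul_const L |>.smul_const eZ)

/-! ### The periodic axial shift of the cell -/

variable (L) in
/-- **The periodic axial shift** `τ_a x = x + a e_z − ⌊(z + a)/L⌋ L e_z` of the cell: translation by
`a` in `z` followed by reduction into the fundamental slab — the action of `ℝ/Lℤ` on the period cell
`{r < 1} × (0, L)` (up to its null faces). [folklore] -/
def cellShift (a : ℝ) (x : ℝ³) : ℝ³ := axialRed L (x + a • eZ)

/-- Unfolding the periodic shift. [folklore] -/
theorem cellShift_apply (a : ℝ) (x : ℝ³) : cellShift L a x = axialRed L (x + a • eZ) := rfl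

/-- The periodic shift is measurable. [folklore] -/
theorem measurable_cellShift (a : ℝ) : Measurable (cellShift L a) :=
  measurable_axialRed.comp (measurable_id.add_const _)

/-- The periodic shift does not change the radius. [folklore] -/
theorem cylRadius_cellShift (a : ℝ) (x : ℝ³) : cylRadius (cellShift L a x) = cylRadius x := by
  rw [cellShift_apply, cylRadius_axialRed, cylRadius_add_smul_eZ]

/-- A periodic function composed with the periodic shift is the translated function. [folklore] -/
theorem _root_.Literature.Analysis.FluidPDE.IsAxiallyPeriodic.comp_cellShift {F : Sort*} {v : ℝ³ → F}
    (hv : IsAxiallyPeriodic L v) (a : ℝ) (x : ℝ³) : v (cellShift L a x) = v (x + a • eZ) :=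
  hv.comp_axialRed _

/-- The periodic shift maps the cylinder into the closed slab `0 ≤ z < L`. [folklore] -/
theorem cellShift_apply_two_mem (hL : 0 < L) (a : ℝ) (x : ℝ³) : cellShift L a x 2 ∈ Ico 0 L :=
  ⟨axialRed_apply_two_nonneg hL _, axialRed_apply_two_lt hL _⟩

/-! ### Integrals of periodic functions over the cell are shift invariant -/

/-- The cell as the product condition `r < 1`, `0 < z < L`, with the axial translate
`{y | y − c e_z ∈ cell} = {r < 1} × (c, c + L)`. [folklore] -/
theorem mem_axialTranslate_iff (c : ℝ) (y : ℝ³) :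
    y - c • eZ ∈ (cylinderCell L : Set ℝ³) ↔ cylRadius y < 1 ∧ y 2 ∈ Ioo c (c + L) := by
  rw [SetLike.mem_coe, mem_cylinderCell, sub_eq_add_neg, ← neg_smul, cylRadius_add_smul_eZ]
  simp only [mem_Ioo, PiLp.add_apply, smul_eZ_apply_two]
  constructor
  · rintro ⟨hr, h1, h2⟩; exact ⟨hr, by linarith, by linarith⟩
  · rintro ⟨hr, h1, h2⟩; exact ⟨hr, by linarith, by linarith⟩

/-- The face `{z = c}` is null. [folklore] -/
theorem volume_face_eq_zero (c : ℝ) : volume {x : ℝ³ | x 2 = c} = 0 := volume_setOf_apply_two_eq c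

/-- **Shift invariance of cell integrals of periodic functions** (`0 ≤ c < L`): for `G ≥ 0`
`L`-periodic, `∫⁻_cell G(· + c e_z) = ∫⁻_cell G`. The translate `{r<1} × (c, c+L)` of the cell
splits at `z = L` into `{r<1} × (c, L) ⊆ cell` and the `L`-translate of `{r<1} × (0, c) ⊆ cell`,
up to null faces. [folklore] -/
theorem setLIntegral_comp_add_smul_eZ_of_mem_Ico {G : ℝ³ → ℝ≥0∞}
    (hG : IsAxiallyPeriodic L G) {c : ℝ} (hc : c ∈ Ico 0 L) :
    ∫⁻ x in (cylinderCell L : Set ℝ³), G (x + c • eZ) = ∫⁻ x in (cylinderCell L : Set ℝ³), G x := by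
  have hT := lintegral_axialTranslate_cylinderCell_eq L c G
  rw [← eZ_eq_single] at hT
  rw [← hT]
  -- the pieces
  set T : Set ℝ³ := {y | y - c • eZ ∈ (cylinderCell L : Set ℝ³)} with hTdef
  set T₁ : Set ℝ³ := {y | cylRadius y < 1 ∧ y 2 ∈ Ioo c L} with hT₁
  set T₂ : Set ℝ³ := {y | cylRadius y < 1 ∧ y 2 ∈ Ioo L (c + L)} with hT₂
  set S₂ : Set ℝ³ := {y | cylRadius y < 1 ∧ y 2 ∈ Ioo 0 c} with hS₂
  have hmr : Measurable (cylRadius : ℝ³ → ℝ) := continuous_cylRadius.measurable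
  have hm2 : Measurable fun y : ℝ³ => y 2 := (EuclideanSpace.proj (2 : Fin 3)).continuous.measurable
  have hT₁m : MeasurableSet T₁ := (measurableSet_lt hmr measurable_const).inter (hm2 measurableSet_Ioo)
  have hT₂m : MeasurableSet T₂ := (measurableSet_lt hmr measurable_const).inter (hm2 measurableSet_Ioo)
  have hS₂m : MeasurableSet S₂ := (measurableSet_lt hmr measurable_const).inter (hm2 measurableSet_Ioo)
  -- `T = T₁ ∪ T₂` up to the null face `z = L`
  have hTae : (T : Set ℝ³) =ᵐ[volume] (T₁ ∪ T₂ : Set ℝ³) := by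
    refine (ae_eq_set).2 ⟨?_, ?_⟩
    · refine measure_mono_null (fun y hy => ?_) (volume_face_eq_zero L)
      have hyT := (mem_axialTranslate_iff c y).1 hy.1
      rcases lt_trichotomy (y 2) L with h | h | h
      · exact absurd (Or.inl ⟨hyT.1, hyT.2.1, h⟩) hy.2
      · exact h
      · exact absurd (Or.inr ⟨hyT.1, h, hyT.2.2⟩) hy.2
    · refine measure_mono_null (fun y hy => ?_) (measure_empty (μ := (volume : Measure ℝ³)))
      rcases hy.1 with h | h
      · exact hy.2 ((mem_axialTranslate_iff c y).2 ⟨h.1, h.2.1, by linarith [h.2.2, hc.1]⟩)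
      · exact hy.2 ((mem_axialTranslate_iff c y).2 ⟨h.1, by linarith [h.2.1, hc.2], h.2.2⟩)
  -- `cell = T₁ ∪ S₂` up to the null face `z = c`
  have hCae : (cylinderCell L : Set ℝ³) =ᵐ[volume] (T₁ ∪ S₂ : Set ℝ³) := by
    refine (ae_eq_set).2 ⟨?_, ?_⟩
    · refine measure_mono_null (fun y hy => ?_) (volume_face_eq_zero c)
      have hyC : cylRadius y < 1 ∧ y 2 ∈ Ioo 0 L := hy.1
      rcases lt_trichotomy (y 2) c with h | h | h
      · exact absurd (Or.inr ⟨hyC.1, hyC.2.1, h⟩) hy.2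
      · exact h
      · exact absurd (Or.inl ⟨hyC.1, h, hyC.2.2⟩) hy.2
    · refine measure_mono_null (fun y hy => ?_) (measure_empty (μ := (volume : Measure ℝ³)))
      rcases hy.1 with h | h
      · exact hy.2 ⟨h.1, by linarith [h.2.1, hc.1], h.2.2⟩
      · exact hy.2 ⟨h.1, h.2.1, by linarith [h.2.2, hc.2]⟩
  have hdisj₁ : Disjoint T₁ T₂ := by
    rw [Set.disjoint_left]
    rintro y ⟨-, -, h1⟩ ⟨-, h2, -⟩
    linarith
  have hdisj₂ : Disjoint T₁ S₂ := by
    rw [Set.disjoint_left]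
    rintro y ⟨-, h1, -⟩ ⟨-, -, h2⟩
    linarith
  -- `T₂` is the `L`-translate of `S₂`
  have hT₂S₂ : T₂ = {y | y - L • eZ ∈ S₂} := by
    ext y
    simp only [hT₂, hS₂, mem_setOf_eq, sub_eq_add_neg, ← neg_smul, cylRadius_add_smul_eZ,
      PiLp.add_apply, smul_eZ_apply_two, mem_Ioo]
    constructor
    · rintro ⟨hr, h1, h2⟩; exact ⟨hr, by linarith, by linarith⟩
    · rintro ⟨hr, h1, h2⟩; exact ⟨hr, by linarith, by linarith⟩
  have hT₂int : ∫⁻ y in T₂, G y = ∫⁻ y in S₂, G y := by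
    rw [hT₂S₂]
    -- translation invariance, then periodicity
    have hpre : MeasurableSet {y : ℝ³ | y - L • eZ ∈ S₂} :=
      hS₂m.preimage (measurable_id.sub measurable_const)
    have h1 : ∫⁻ y in {y : ℝ³ | y - L • eZ ∈ S₂}, G y = ∫⁻ y in S₂, G (y + L • eZ) := by
      rw [← lintegral_indicator hS₂m, ← lintegral_indicator hpre, ← lintegral_add_right_eq_self
        (fun y => ({y : ℝ³ | y - L • eZ ∈ S₂}).indicator G y) (L • eZ)]
      congr 1
      funext y
      have hmem : y + L • eZ ∈ {y : ℝ³ | y - L • eZ ∈ S₂} ↔ y ∈ S₂ := by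
        rw [mem_setOf_eq, add_sub_cancel_right]
      by_cases hy : y ∈ S₂
      · rw [indicator_of_mem (hmem.2 hy), indicator_of_mem hy]
      · rw [indicator_of_notMem (fun h => hy (hmem.1 h)), indicator_of_notMem hy]
    rw [h1]
    exact setLIntegral_congr_fun hS₂m fun y _ => hG y
  rw [setLIntegral_congr hTae, setLIntegral_congr hCae, lintegral_union hT₂m hdisj₁,
    lintegral_union hS₂m hdisj₂, hT₂int]

/-- **Shift invariance of cell integrals of periodic functions**: for every real `c` and every
`L`-periodic `G ≥ 0`, `∫⁻_cell G(· + c e_z) = ∫⁻_cell G`. [folklore] -/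
theorem setLIntegral_comp_add_smul_eZ (hL : 0 < L) {G : ℝ³ → ℝ≥0∞} (hG : IsAxiallyPeriodic L G)
    (c : ℝ) :
    ∫⁻ x in (cylinderCell L : Set ℝ³), G (x + c • eZ) = ∫⁻ x in (cylinderCell L : Set ℝ³), G x := by
  -- reduce `c` modulo `L`
  set c' : ℝ := c - (⌊c / L⌋ : ℝ) * L with hc'
  have hc'mem : c' ∈ Ico 0 L := ⟨Int.sub_floor_div_mul_nonneg c hL, Int.sub_floor_div_mul_lt c hL⟩
  have hred : ∀ x : ℝ³, G (x + c • eZ) = G (x + c' • eZ) := fun x => by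
    have h := hG.add_int_mul_smul_eZ ⌊c / L⌋ (x + c' • eZ)
    rw [add_assoc, ← add_smul] at h
    have hcc : c' + (⌊c / L⌋ : ℝ) * L = c := by rw [hc']; ring
    rw [hcc] at h
    exact h
  simp_rw [hred]
  exact setLIntegral_comp_add_smul_eZ_of_mem_Ico hG hc'mem

/-! ### The periodic shift preserves the cell measure -/

/-- **The periodic axial shift preserves the cell measure**: `(τ_a)_* (vol|_cell) = vol|_cell`.
Proof: for measurable `g ≥ 0`, `∫_cell g(τ_a x) = ∫_cell (g ∘ red)(x + a e_z) = ∫_cell g ∘ red = ∫_cell g`,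
by shift invariance for the periodic function `g ∘ red` and `red = id` on the cell. [folklore] -/
theorem map_cellShift_eq (hL : 0 < L) (a : ℝ) :
    Measure.map (cellShift L a) (volume.restrict (cylinderCell L : Set ℝ³)) =
      volume.restrict (cylinderCell L : Set ℝ³) := by
  refine Measure.ext_of_lintegral _ fun g hg => ?_
  rw [lintegral_map hg (measurable_cellShift a)]
  have hper : IsAxiallyPeriodic L (fun x => g (axialRed L x)) := fun x => by
    simp only [← eZ_eq_single, axialRed_add_period hL x]
  have h := setLIntegral_comp_add_smul_eZ hL hper a
  simp only [cellShift_apply] at h ⊢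
  rw [h]
  exact setLIntegral_congr_fun (cylinderCell L).isOpen.measurableSet fun x hx => by
    rw [axialRed_eq_self_of_mem_cell hL hx]

/-- The periodic axial shift is measure preserving on the cell. [folklore] -/
theorem measurePreserving_cellShift (hL : 0 < L) (a : ℝ) :
    MeasurePreserving (cellShift L a) (volume.restrict (cylinderCell L : Set ℝ³))
      (volume.restrict (cylinderCell L : Set ℝ³)) :=
  ⟨measurable_cellShift a, map_cellShift_eq hL a⟩

/-! ### Rotations about the axis preserve the cell measure -/

/-- Rotations about the axis preserve the cell. [folklore] -/
theorem rotZ_preimage_cylinderCell (θ : ℝ) :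
    rotZ θ ⁻¹' (cylinderCell L : Set ℝ³) = (cylinderCell L : Set ℝ³) := by
  ext x
  simp only [mem_preimage, SetLike.mem_coe, mem_cylinderCell, cylRadius_rotZ, rotZ_apply_two]

/-- **Rotations about the axis are measure preserving on the cell.** [folklore] -/
theorem measurePreserving_rotZ_cell (θ : ℝ) :
    MeasurePreserving (rotZ θ) (volume.restrict (cylinderCell L : Set ℝ³))
      (volume.restrict (cylinderCell L : Set ℝ³)) := by
  have h : MeasurePreserving (rotZ θ) (volume : Measure ℝ³) volume := (rotZLIE θ).measurePreserving
  have := h.restrict_preimage (cylinderCell L).isOpen.measurableSet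
  rwa [rotZ_preimage_cylinderCell] at this

/-! ### Bochner integrals over the cell are invariant -/

section Bochner

variable {E : Type*} [NormedAddCommGroup E] [NormedSpace ℝ E]

/-- `∫_cell f ∘ τ_a = ∫_cell f`. [folklore] -/
theorem integral_comp_cellShift (hL : 0 < L) (a : ℝ) {f : ℝ³ → E}
    (hf : AEStronglyMeasurable f (cellMeasure L)) :
    ∫ x in (cylinderCell L : Set ℝ³), f (cellShift L a x) = ∫ x in (cylinderCell L : Set ℝ³), f x := by
  have h := (measurePreserving_cellShift hL a)
  have hf' : AEStronglyMeasurable f (Measure.map (cellShift L a) (cellMeasure L)) := by rwa [h.map_eq]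
  rw [← integral_map h.measurable.aemeasurable hf', h.map_eq]

/-- **`∫_cell F(· + a e_z) = ∫_cell F`** for `F` periodic (Bochner integral). [folklore] -/
theorem integral_comp_add_smul_eZ (hL : 0 < L) (a : ℝ) {F : ℝ³ → E} (hF : IsAxiallyPeriodic L F)
    (hFm : AEStronglyMeasurable F (cellMeasure L)) :
    ∫ x in (cylinderCell L : Set ℝ³), F (x + a • eZ) = ∫ x in (cylinderCell L : Set ℝ³), F x := by
  rw [← integral_comp_cellShift hL a hFm]
  exact integral_congr_ae (Eventually.of_forall fun x => (hF.comp_cellShift a x).symm)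

/-- `∫_cell f ∘ R_θ = ∫_cell f`. [folklore] -/
theorem integral_comp_rotZ_cell (θ : ℝ) {f : ℝ³ → E} (hf : AEStronglyMeasurable f (cellMeasure L)) :
    ∫ x in (cylinderCell L : Set ℝ³), f (rotZ θ x) = ∫ x in (cylinderCell L : Set ℝ³), f x := by
  have h := (measurePreserving_rotZ_cell (L := L) θ)
  have hf' : AEStronglyMeasurable f (Measure.map (rotZ θ) (cellMeasure L)) := by rwa [h.map_eq]
  rw [← integral_map h.measurable.aemeasurable hf', h.map_eq]

end Bochner

/-! ### The unitary actions on `L²(cell)` -/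

section Actions

variable {E : Type*} [NormedAddCommGroup E]

variable (L) in
/-- **The periodic axial shift on `L²(cell; E)`**: `U_a f = f ∘ τ_a`, a linear isometry
(composition with the measure-preserving `cellShift L a`; the identity if `L ≤ 0`, junk). [folklore] -/
def axialShiftLp [NormedSpace ℝ E] (a : ℝ) : Lp E 2 (cellMeasure L) →ₗᵢ[ℝ] Lp E 2 (cellMeasure L) :=
  if h : 0 < L then Lp.compMeasurePreservingₗᵢ ℝ (cellShift L a) (measurePreserving_cellShift h a)
  else LinearIsometry.id

/-- The shifted class is the composition with the periodic shift, a.e. on the cell. [folklore] -/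
theorem coeFn_axialShiftLp [NormedSpace ℝ E] (hL : 0 < L) (a : ℝ) (f : Lp E 2 (cellMeasure L)) :
    axialShiftLp L a f =ᵐ[cellMeasure L] fun x => f (cellShift L a x) := by
  rw [axialShiftLp, dif_pos hL]
  exact Lp.coeFn_compMeasurePreserving f (measurePreserving_cellShift hL a)

/-- The shift of the class of a periodic function is the class of the translated function. [folklore] -/
theorem axialShiftLp_toLp [NormedSpace ℝ E] (hL : 0 < L) (a : ℝ) {F : ℝ³ → E} (hF : IsAxiallyPeriodic L F)
    (hFm : MemLp F 2 (cellMeasure L)) (hFam : MemLp (fun x => F (x + a • eZ)) 2 (cellMeasure L)) :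
    axialShiftLp L a (hFm.toLp F) = hFam.toLp _ := by
  refine Lp.ext_iff.2 ?_
  filter_upwards [coeFn_axialShiftLp hL a (hFm.toLp F), hFam.coeFn_toLp,
    (measurePreserving_cellShift hL a).quasiMeasurePreserving.ae_eq (hFm.coeFn_toLp)] with x hx h2 h3
  simp only [Function.comp_apply] at h3
  rw [hx, h2, h3, hF.comp_cellShift]

/-- A periodic function translated in `z` is square integrable on the cell if the function is.
[folklore] -/
theorem memLp_comp_add_smul_eZ (hL : 0 < L) (a : ℝ) {F : ℝ³ → E} (hF : IsAxiallyPeriodic L F)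
    (hFm : MemLp F 2 (cellMeasure L)) : MemLp (fun x => F (x + a • eZ)) 2 (cellMeasure L) := by
  have h := hFm.comp_measurePreserving (measurePreserving_cellShift hL a)
  refine h.ae_eq (Eventually.of_forall fun x => ?_)
  simp only [Function.comp_apply, hF.comp_cellShift]

variable (L) in
/-- **Rotations about the axis on `L²(cell; E)`** (scalar action): `R_θ f = f ∘ rotZ θ`, a linear
isometry. [folklore] -/
def rotLp [NormedSpace ℝ E] (θ : ℝ) : Lp E 2 (cellMeasure L) →ₗᵢ[ℝ] Lp E 2 (cellMeasure L) :=
  Lp.compMeasurePreservingₗᵢ ℝ (rotZ θ) (measurePreserving_rotZ_cell θ)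

/-- The rotated class is the composition with the rotation, a.e. on the cell. [folklore] -/
theorem coeFn_rotLp [NormedSpace ℝ E] (θ : ℝ) (f : Lp E 2 (cellMeasure L)) :
    rotLp L θ f =ᵐ[cellMeasure L] fun x => f (rotZ θ x) :=
  Lp.coeFn_compMeasurePreserving f (measurePreserving_rotZ_cell θ)

/-- A function composed with a rotation is square integrable on the cell if the function is. [folklore] -/
theorem memLp_comp_rotZ (θ : ℝ) {F : ℝ³ → E} (hFm : MemLp F 2 (cellMeasure L)) :
    MemLp (fun x => F (rotZ θ x)) 2 (cellMeasure L) :=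
  hFm.comp_measurePreserving (measurePreserving_rotZ_cell θ)

/-- The rotation of the class of a function is the class of the rotated function. [folklore] -/
theorem rotLp_toLp [NormedSpace ℝ E] (θ : ℝ) {F : ℝ³ → E} (hFm : MemLp F 2 (cellMeasure L)) :
    rotLp L θ (hFm.toLp F) = (memLp_comp_rotZ θ hFm).toLp _ := by
  refine Lp.ext_iff.2 ?_
  filter_upwards [coeFn_rotLp θ (hFm.toLp F), (memLp_comp_rotZ θ hFm).coeFn_toLp,
    (measurePreserving_rotZ_cell (L := L) θ).quasiMeasurePreserving.ae_eq (hFm.coeFn_toLp)]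
    with x hx h2 h3
  rw [hx, h2]
  exact h3

/-- Post-composition of an `L²(cell; ℝ³)` class with the rotation `R_{−θ}` of the values. [folklore] -/
theorem norm_compLp_rotZL (θ : ℝ) (v : Lp ℝ³ 2 (cellMeasure L)) :
    ‖(rotZL θ).compLp v‖ = ‖v‖ := by
  rw [Lp.norm_def, Lp.norm_def]
  congr 1
  refine eLpNorm_congr_norm_ae ?_
  filter_upwards [(rotZL θ).coeFn_compLp v] with x hx
  rw [hx, rotZL_apply, norm_rotZ]

variable (L) in
/-- **Rotations about the axis on `L²(cell; ℝ³)`** (action on vector fields):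
`(R_θ v)(x) = R_{−θ} (v (R_θ x))` — the pull-back under which gradients of rotated potentials are the
rotated gradients (`∇(q ∘ R_θ) = R_θ⁻¹ (∇q) ∘ R_θ`); a linear isometry. [folklore] -/
def rotFieldLp (θ : ℝ) : Lp ℝ³ 2 (cellMeasure L) →ₗᵢ[ℝ] Lp ℝ³ 2 (cellMeasure L) where
  toLinearMap := ((rotZL (-θ)).compLpₗ 2 (cellMeasure L)).comp (rotLp L θ).toLinearMap
  norm_map' v := by
    show ‖(rotZL (-θ)).compLp (rotLp L θ v)‖ = ‖v‖
    rw [norm_compLp_rotZL, LinearIsometry.norm_map]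

/-- The rotated field class is `x ↦ R_{−θ} v(R_θ x)`, a.e. on the cell. [folklore] -/
theorem coeFn_rotFieldLp (θ : ℝ) (v : Lp ℝ³ 2 (cellMeasure L)) :
    rotFieldLp L θ v =ᵐ[cellMeasure L] fun x => rotZ (-θ) (v (rotZ θ x)) := by
  have h1 : (rotFieldLp L θ v : Lp ℝ³ 2 (cellMeasure L)) = (rotZL (-θ)).compLp (rotLp L θ v) := rfl
  rw [h1]
  filter_upwards [(rotZL (-θ)).coeFn_compLp (rotLp L θ v),
    (measurePreserving_rotZ_cell (L := L) θ).quasiMeasurePreserving.ae_eq (coeFn_rotLp θ v),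
    coeFn_rotLp θ v] with x hx _ h3
  rw [hx, rotZL_apply, h3]

/-- The rotation of the class of a field is the class of the rotated field. [folklore] -/
theorem rotFieldLp_toLp (θ : ℝ) {F : ℝ³ → ℝ³} (hFm : MemLp F 2 (cellMeasure L))
    (hFθ : MemLp (fun x => rotZ (-θ) (F (rotZ θ x))) 2 (cellMeasure L)) :
    rotFieldLp L θ (hFm.toLp F) = hFθ.toLp _ := by
  refine Lp.ext_iff.2 ?_
  filter_upwards [coeFn_rotFieldLp θ (hFm.toLp F), hFθ.coeFn_toLp,
    (measurePreserving_rotZ_cell (L := L) θ).quasiMeasurePreserving.ae_eq (hFm.coeFn_toLp)]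
    with x hx h2 h3
  simp only [Function.comp_apply] at h3
  rw [hx, h2, h3]

/-- A field conjugated by a rotation is square integrable on the cell if the field is. [folklore] -/
theorem memLp_rotZ_comp_rotZ (θ : ℝ) {F : ℝ³ → ℝ³} (hFm : MemLp F 2 (cellMeasure L)) :
    MemLp (fun x => rotZ (-θ) (F (rotZ θ x))) 2 (cellMeasure L) := by
  have h := (rotZL (-θ)).comp_memLp' (memLp_comp_rotZ θ hFm)
  exact h

end Actions

/-! ### The actions on cell classes of functions and on the smooth periodic class -/

section ToCell

variable {E : Type*} [NormedAddCommGroup E] [NormedSpace ℝ E]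

/-- **The shift of the cell class of a periodic function is the class of its translate.** [folklore] -/
theorem axialShiftLp_toCell (hL : 0 < L) (a : ℝ) {F : ℝ³ → E} (hF : IsAxiallyPeriodic L F)
    (hFm : MemLp F 2 (cellMeasure L)) :
    axialShiftLp L a (toCell L F) = toCell L (fun x => F (x + a • eZ)) := by
  rw [toCell_eq_toLp hFm, toCell_eq_toLp (memLp_comp_add_smul_eZ hL a hF hFm)]
  exact axialShiftLp_toLp hL a hF hFm _

/-- **The rotation of the cell class of a function is the class of the rotated function.** [folklore] -/
theorem rotLp_toCell (θ : ℝ) {F : ℝ³ → E} (hFm : MemLp F 2 (cellMeasure L)) :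
    rotLp L θ (toCell L F) = toCell L (fun x => F (rotZ θ x)) := by
  rw [toCell_eq_toLp hFm, toCell_eq_toLp (memLp_comp_rotZ θ hFm)]
  exact rotLp_toLp θ hFm

/-- **The rotation of the cell class of a field is the class of the conjugated field.** [folklore] -/
theorem rotFieldLp_toCell (θ : ℝ) {F : ℝ³ → ℝ³} (hFm : MemLp F 2 (cellMeasure L)) :
    rotFieldLp L θ (toCell L F) = toCell L (fun x => rotZ (-θ) (F (rotZ θ x))) := by
  rw [toCell_eq_toLp hFm, toCell_eq_toLp (memLp_rotZ_comp_rotZ θ hFm)]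
  exact rotFieldLp_toLp θ hFm _

/-- Axial translates of smooth periodic functions are smooth periodic. [folklore] -/
theorem IsSmoothPeriodic.comp_add_smul_eZ {F : ℝ³ → E} (hF : IsSmoothPeriodic L F) (a : ℝ) :
    IsSmoothPeriodic L (fun x => F (x + a • eZ)) where
  smooth := by
    refine hF.smooth.comp (contDiffOn_id.add contDiffOn_const) fun x hx => ?_
    exact (add_axialShift_mem_closure_unitCylinder_iff a).2 hx
  periodic := fun x => by
    have h := hF.periodic (x + a • eZ)
    simp only [← eZ_eq_single] at h ⊢
    rw [add_right_comm]
    exact h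

/-- Rotated smooth periodic functions are smooth periodic. [folklore] -/
theorem IsSmoothPeriodic.comp_rotZ {F : ℝ³ → E} (hF : IsSmoothPeriodic L F) (θ : ℝ) :
    IsSmoothPeriodic L (fun x => F (rotZ θ x)) where
  smooth := by
    refine hF.smooth.comp (rotZL θ).contDiff.contDiffOn fun x hx => ?_
    exact (rotZ_mem_closure_unitCylinder_iff θ).2 hx
  periodic := hF.periodic.comp_rotZ θ

/-- Conjugated smooth periodic fields are smooth periodic. [folklore] -/
theorem IsSmoothPeriodic.rotZ_comp_rotZ {F : ℝ³ → ℝ³} (hF : IsSmoothPeriodic L F) (θ : ℝ) :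
    IsSmoothPeriodic L (fun x => rotZ (-θ) (F (rotZ θ x))) where
  smooth := ((rotZL (-θ)).contDiff.comp_contDiffOn (hF.comp_rotZ θ).smooth)
  periodic := fun x => by
    have h := (hF.comp_rotZ θ).periodic x
    exact congrArg (rotZ (-θ)) h

end ToCell

/-! ### Periodisation of test functions on the cell -/

variable (L) in
/-- **The periodisation of a function supported in the cell**: `x ↦ φ(red x)`, the `L`-periodic
function agreeing with `φ` on the cell. [folklore] -/
def periodize (φ : ℝ³ → ℝ) : ℝ³ → ℝ := fun x => φ (axialRed L x)

/-- The periodisation is `L`-periodic. [folklore] -/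
theorem isAxiallyPeriodic_periodize (hL : 0 < L) (φ : ℝ³ → ℝ) : IsAxiallyPeriodic L (periodize L φ) :=
  fun x => by
    simp only [periodize, ← eZ_eq_single, axialRed_add_period hL x]

/-- The periodisation agrees with the function on the cell. [folklore] -/
theorem periodize_eq_self (hL : 0 < L) (φ : ℝ³ → ℝ) {y : ℝ³} (hx : y ∈ (cylinderCell L : Set ℝ³)) :
    periodize L φ y = φ y := by
  simp only [periodize, axialRed_eq_self_of_mem_cell hL hx]

/-- A compact subset of the cell keeps a positive distance from the end faces: its axial coordinates
lie in some `[δ, L − δ]`, `δ > 0`. [folklore] -/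
theorem exists_axial_margin {K : Set ℝ³} (hK : IsCompact K) (hKc : K ⊆ (cylinderCell L : Set ℝ³)) :
    ∃ δ : ℝ, 0 < δ ∧ ∀ x ∈ K, δ ≤ x 2 ∧ x 2 ≤ L - δ := by
  by_cases hne : K.Nonempty
  · have h2 : Continuous fun x : ℝ³ => x 2 := (EuclideanSpace.proj (2 : Fin 3)).continuous
    obtain ⟨a, haK, ha⟩ := hK.exists_isMinOn hne h2.continuousOn
    obtain ⟨b, hbK, hb⟩ := hK.exists_isMaxOn hne h2.continuousOn
    have ha0 : 0 < a 2 := (hKc haK).2.1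
    have hbL : b 2 < L := (hKc hbK).2.2
    refine ⟨min (a 2) (L - b 2), lt_min ha0 (by linarith), fun x hx => ⟨?_, ?_⟩⟩
    · exact (min_le_left _ _).trans (ha hx)
    · have := hb hx
      have h3 : min (a 2) (L - b 2) ≤ L - b 2 := min_le_right _ _
      simp only [mem_setOf_eq] at this
      linarith
  · refine ⟨1, one_pos, fun x hx => absurd ⟨x, hx⟩ hne⟩

/-- **The periodisation of a test function on the cell is smooth**: near a point off the end faces
the axial reduction is a constant translation; near a point of an end face `{z ∈ Lℤ}` the
periodisation vanishes identically, the support of the test function keeping a positive distance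
from the faces of the cell. [folklore] -/
theorem contDiff_periodize (hL : 0 < L) {φ : ℝ³ → ℝ} (hφ : IsTestFunctionOn (cylinderCell L) φ) :
    ContDiff ℝ ∞ (periodize L φ) := by
  obtain ⟨δ, hδ, hmargin⟩ := exists_axial_margin hφ.hasCompactSupport hφ.tsupport_subset
  have h2c : Continuous fun x : ℝ³ => x 2 := (EuclideanSpace.proj (2 : Fin 3)).continuous
  rw [contDiff_iff_contDiffAt]
  intro x
  -- the fractional position of `x 2`
  set k : ℤ := ⌊x 2 / L⌋ with hk
  by_cases hface : x 2 - (k : ℝ) * L < δ ∨ L - δ < x 2 - (k : ℝ) * L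
  · -- near a face: the periodisation vanishes near `x`
    have hzero : ∀ᶠ y in 𝓝 x, periodize L φ y = 0 := by
      -- `y 2 - ⌊y 2 / L⌋ L` stays within `δ` of a face for `y` near `x`
      have hcont : ContinuousAt (fun y : ℝ³ => y 2) x := h2c.continuousAt
      have hred0 : 0 ≤ x 2 - (k : ℝ) * L := Int.sub_floor_div_mul_nonneg (x 2) hL
      have hredL : x 2 - (k : ℝ) * L < L := Int.sub_floor_div_mul_lt (x 2) hL
      rcases hface with hlo | hhi
      · -- `x 2 ∈ [kL, kL + δ)`: for `y 2 ∈ (kL - δ', kL + δ)` the reduction of `y` is `< δ` or `> L - δ`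
        have hev : ∀ᶠ y in 𝓝 x, (k : ℝ) * L - δ < y 2 ∧ y 2 < (k : ℝ) * L + δ :=
          hcont.eventually (Ioo_mem_nhds (by linarith) (by linarith))
        filter_upwards [hev] with y hy
        simp only [periodize]
        apply image_eq_zero_of_notMem_tsupport
        intro hmem
        have hm := hmargin _ hmem
        rw [axialRed_apply_two] at hm
        -- `⌊y 2 / L⌋ ∈ {k - 1, k}`
        have hy0 : 0 ≤ y 2 - (⌊y 2 / L⌋ : ℝ) * L := Int.sub_floor_div_mul_nonneg (y 2) hL
        have hyL : y 2 - (⌊y 2 / L⌋ : ℝ) * L < L := Int.sub_floor_div_mul_lt (y 2) hL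
        rcases lt_or_ge (y 2) ((k : ℝ) * L) with hlt | hge
        · -- then `⌊y 2 / L⌋ ≤ k - 1`, reduction `= y 2 - ⌊⌋L ≥ y2 - (k-1)L > L - δ`
          have hfl : ⌊y 2 / L⌋ ≤ k - 1 := by
            have : ⌊y 2 / L⌋ < k := by
              rw [Int.floor_lt]; rw [div_lt_iff₀ hL]; exact_mod_cast hlt
            omega
          have hfl' : (⌊y 2 / L⌋ : ℝ) ≤ (k : ℝ) - 1 := by exact_mod_cast hfl
          have : y 2 - (⌊y 2 / L⌋ : ℝ) * L ≥ y 2 - ((k : ℝ) - 1) * L := by nlinarith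
          linarith [hm.2]
        · have hfl : k ≤ ⌊y 2 / L⌋ := by
            rw [Int.le_floor]; rw [le_div_iff₀ hL]; exact_mod_cast hge
          have hfl' : (k : ℝ) ≤ (⌊y 2 / L⌋ : ℝ) := by exact_mod_cast hfl
          have : y 2 - (⌊y 2 / L⌋ : ℝ) * L ≤ y 2 - (k : ℝ) * L := by nlinarith
          linarith [hm.1]
      · -- `x 2 ∈ (kL + L - δ, kL + L)`: for `y 2` near, reduction `> L - δ` or `< δ`
        have hev : ∀ᶠ y in 𝓝 x, (k : ℝ) * L + L - δ < y 2 ∧ y 2 < (k : ℝ) * L + L + δ :=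
          hcont.eventually (Ioo_mem_nhds (by linarith) (by linarith))
        filter_upwards [hev] with y hy
        simp only [periodize]
        apply image_eq_zero_of_notMem_tsupport
        intro hmem
        have hm := hmargin _ hmem
        rw [axialRed_apply_two] at hm
        have hy0 : 0 ≤ y 2 - (⌊y 2 / L⌋ : ℝ) * L := Int.sub_floor_div_mul_nonneg (y 2) hL
        have hyL : y 2 - (⌊y 2 / L⌋ : ℝ) * L < L := Int.sub_floor_div_mul_lt (y 2) hL
        rcases lt_or_ge (y 2) ((k : ℝ) * L + L) with hlt | hge
        · have hfl : ⌊y 2 / L⌋ ≤ k := by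
            have : ⌊y 2 / L⌋ < k + 1 := by
              rw [Int.floor_lt]; rw [div_lt_iff₀ hL]; push_cast; linarith
            omega
          have hfl' : (⌊y 2 / L⌋ : ℝ) ≤ (k : ℝ) := by exact_mod_cast hfl
          have : y 2 - (⌊y 2 / L⌋ : ℝ) * L ≥ y 2 - (k : ℝ) * L := by nlinarith
          linarith [hm.2]
        · have hfl : k + 1 ≤ ⌊y 2 / L⌋ := by
            rw [Int.le_floor]; rw [le_div_iff₀ hL]; push_cast; linarith
          have hfl' : (k : ℝ) + 1 ≤ (⌊y 2 / L⌋ : ℝ) := by exact_mod_cast hfl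
          have : y 2 - (⌊y 2 / L⌋ : ℝ) * L ≤ y 2 - ((k : ℝ) + 1) * L := by nlinarith
          linarith [hm.1]
    exact contDiffAt_const.congr_of_eventuallyEq hzero
  · -- away from the faces: `⌊y 2 / L⌋ = k` near `x`, the reduction is a translation
    push Not at hface
    obtain ⟨hlo, hhi⟩ := hface
    have hcont : ContinuousAt (fun y : ℝ³ => y 2) x := h2c.continuousAt
    have hev : ∀ᶠ y in 𝓝 x, (k : ℝ) * L < y 2 ∧ y 2 < (k : ℝ) * L + L :=
      hcont.eventually (Ioo_mem_nhds (by linarith) (by linarith))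
    have hfloor : ∀ᶠ y in 𝓝 x, ⌊y 2 / L⌋ = k := by
      filter_upwards [hev] with y hy
      rw [Int.floor_eq_iff, le_div_iff₀ hL, div_lt_iff₀ hL]
      exact ⟨by linarith [hy.1], by linarith [hy.2]⟩
    have heq : ∀ᶠ y in 𝓝 x, periodize L φ y = φ (y - ((k : ℝ) * L) • eZ) := by
      filter_upwards [hfloor] with y hy
      simp only [periodize, axialRed, hy]
    refine ContDiffAt.congr_of_eventuallyEq ?_ heq
    exact (hφ.contDiff.comp (contDiff_id.sub contDiff_const)).contDiffAt

/-- The periodisation of a test function on the cell is smooth on the closed cylinder and periodic;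
its derivatives on the cell are those of the test function. [folklore] -/
theorem fderiv_periodize_eq (hL : 0 < L) {φ : ℝ³ → ℝ} {x : ℝ³} (hx : x ∈ (cylinderCell L : Set ℝ³)) :
    fderiv ℝ (periodize L φ) x = fderiv ℝ φ x := by
  refine Filter.EventuallyEq.fderiv_eq ?_
  filter_upwards [(cylinderCell L).isOpen.mem_nhds hx] with y hy
  exact periodize_eq_self hL φ (y := y) hy

end PeriodicCylinder

end Literature.Analysis.FluidPDE
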